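import Summits.Ventures.WeilGRH.ZetaFlatWindowSpectral
import Summits.Ventures.WeilGRH.FlatWindowAtoms
import HarnessLib

/-!
# rh-explicit (venture WeilGRH): THE MULTIPLICITY IS THE LIMIT — the window forms of the modulated flat
  windows are multiplicity certificates, and they are COMPLETE: `W_a(e^{−iτx}χ_0)/(2a) → μ{τ}`

Cell `rh-explicit`, WEIL TRACK (structure seat weil-3, gen10).  Measure level, closed-form-free companion
of `ZetaWindowAtoms.lean`.  Let `μ` be a positive measure representing Weil's form `W(g ⋆ g̃) = ∫‖ĝ(½+it)‖²dμ`
(on the tests of one window `[-a, a]`, or on all tests), and let `u_{a,τ} = e^{−iτx}χ_0`,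
`χ_0 = (2a)^{-1/2}𝟙_{[-a,a]}`, be the flat window of length `2a` modulated to height `τ`.  Its transform is
the Fejér profile centred at `τ`: `‖û_{a,τ}(½+it)‖² = 2sin²(a(t−τ))/(a(t−τ)²)`, `= 2a` at `t = τ`.

* `two_mul_mul_atom_le_weilWindowForm` (one window, RH-free): `2a·μ{τ} ≤ weilWindowForm a u_{a,τ}` — every
  value of the `ζ` window form on a modulated flat window is an upper bound for the spectral mass at that
  height (its closed form — pole, primes below `e^{2a}`, digamma weight — is `ZetaWindowAtoms.lean`);
* `mul_measureReal_Icc_le_weilWindowForm` (one window, RH-free): `(8a/π²)·μ[τ − π/(2a), τ + π/(2a)] ≤ W_a(u_{a,τ})`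
  (Jordan's inequality on the Fejér profile) — one window bounds the spectral mass of a whole interval;
* `norm_sq_weilMellin_modulated_div_le_majorant`: `‖û_{a,τ}(½+it)‖²/(2a) ≤ 4(1+τ²)(1+t²)⁻¹` for `a ≥ 1`;
* `weilWindowForm_modulated_le_atom_add` (one window, RH-free): `W_a(u_{a,τ}) ≤ 2a·μ{τ} + (2/a)∫(t−τ)⁻²dμ` —
  the RATE of completeness is `a⁻²·∫(t−τ)⁻²dμ` whenever that moment is finite;
* **`tendsto_weilWindowForm_modulated_div`** (all windows, RH-free): if `μ` represents `W` on all tests then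
  for every `τ`, **`weilWindowForm a u_{a,τ} / (2a) → μ{τ}` as `a → ∞`** (dominated convergence against the
  growth law `(1+t²)⁻¹ ∈ L¹(μ)`): the certificates are asymptotically sharp at every height;
* under RH (`μ = Σ_ρ m_ρ δ_γ`, `ZetaWindowAtomsRH.lean`): `W_a(u_{a,τ})/(2a) → ord_{s=½+iτ} ζ(s)` and
  `ord_{s=½+iτ} ζ ≤ k ↔ ∃ a > 0, W_a(u_{a,τ}) < 2a(k+1)` — the multiplicity of every zero (its SIMPLICITY,
  `k = 1`; the non-vanishing at a height, `k = 0`) is DECIDED BY ONE FINITE WINDOW: the window certificates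
  are sound at each `a` and complete in the limit.

No definitions, no named facts; RH-free.
-/

set_option autoImplicit false

noncomputable section

open Complex Filter Set MeasureTheory
open scoped Real Topology ComplexConjugate

namespace Summit.Ventures.WeilGRH

open Literature.NumberTheory.LFunctions
open Literature.NumberTheory.LFunctions.Yoshida1992 (chi chiCore)
open Summit.RiemannHypothesis.RiemannHypothesis.Theorems.WeilFormatC
open Summit.RiemannHypothesis.RiemannHypothesis.Theorems.WeilBochnerMeasure (weilWindowForm_eq_integral
  integrable_inv_one_add_sq)

variable {a : ℝ}

/-! ## One window: the window form of the modulated flat window bounds the atom -/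

/-- The window form of `u_{a,τ} = e^{−iτx}χ_0` is the Fejér integral of `μ` centred at `τ`:
`‖û_{a,τ}(½+it)‖² ∈ L¹(μ)` and `weilWindowForm a u_{a,τ} = ∫ ‖û_{a,τ}(½+it)‖² dμ(t)`. -/
theorem weilWindowForm_modulated_eq_integral (ha : 0 < a) {μ : Measure ℝ}
    (hμ : ∀ g : ℝ → ℂ, IsWeilTest g → tsupport g ⊆ Icc (-a) a →
      Integrable (fun t : ℝ ↦ ‖weilMellin g (1 / 2 + t * I)‖ ^ 2) μ ∧
        weilQuadratic g = ((∫ t, ‖weilMellin g (1 / 2 + t * I)‖ ^ 2 ∂μ : ℝ) : ℂ)) (τ : ℝ) :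
    Integrable (fun t : ℝ ↦
        ‖weilMellin (fun x ↦ cexp (I * ((-τ) * x : ℝ)) * chi a 0 x) (1 / 2 + t * I)‖ ^ 2) μ ∧
      weilWindowForm a (fun x ↦ cexp (I * ((-τ) * x : ℝ)) * chi a 0 x) =
        ∫ t, ‖weilMellin (fun x ↦ cexp (I * ((-τ) * x : ℝ)) * chi a 0 x) (1 / 2 + t * I)‖ ^ 2 ∂μ := by
  obtain ⟨hf, huf⟩ := modulated_chi_zero_smooth_inside a (-τ)
  exact weilWindowForm_eq_integral ha hμ (isWindowFunction_modulated_chi_zero ha (-τ)) hf huf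

/-- **EVERY WINDOW-FORM VALUE IS A MULTIPLICITY CERTIFICATE** (one window, RH-free).  For `a > 0`, every
positive `μ` representing Weil's form on the tests of `[-a, a]` and every `τ ∈ ℝ`:
`2a · μ{τ} ≤ weilWindowForm a (e^{−iτx}χ_0)`. -/
theorem two_mul_mul_atom_le_weilWindowForm (ha : 0 < a) {μ : Measure ℝ}
    (hμ : ∀ g : ℝ → ℂ, IsWeilTest g → tsupport g ⊆ Icc (-a) a →
      Integrable (fun t : ℝ ↦ ‖weilMellin g (1 / 2 + t * I)‖ ^ 2) μ ∧
        weilQuadratic g = ((∫ t, ‖weilMellin g (1 / 2 + t * I)‖ ^ 2 ∂μ : ℝ) : ℂ)) (τ : ℝ) :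
    2 * a * μ.real {τ} ≤ weilWindowForm a (fun x ↦ cexp (I * ((-τ) * x : ℝ)) * chi a 0 x) := by
  obtain ⟨hint, heq⟩ := weilWindowForm_modulated_eq_integral ha hμ τ
  set u : ℝ → ℂ := fun x ↦ cexp (I * ((-τ) * x : ℝ)) * chi a 0 x with hu
  have h0 := measure_singleton_lt_top_of_integrable (integrable_inv_one_add_sq ha hμ) τ
  have hind : Integrable (fun t : ℝ ↦ ({τ} : Set ℝ).indicator (fun _ ↦ 2 * a) t) μ :=
    (integrable_indicator_iff (measurableSet_singleton τ)).2 (integrableOn_const h0.ne)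
  have hle : ∀ t : ℝ, ({τ} : Set ℝ).indicator (fun _ ↦ 2 * a) t ≤ ‖weilMellin u (1 / 2 + t * I)‖ ^ 2 := by
    intro t
    by_cases ht : t ∈ ({τ} : Set ℝ)
    · rw [indicator_of_mem ht, mem_singleton_iff.1 ht, hu, norm_sq_weilMellin_modulated_chi_zero_self ha]
    · rw [indicator_of_notMem ht]; positivity
  calc 2 * a * μ.real {τ} = ∫ t, ({τ} : Set ℝ).indicator (fun _ ↦ 2 * a) t ∂μ := by
        rw [integral_indicator_const _ (measurableSet_singleton τ), smul_eq_mul, mul_comm]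
    _ ≤ ∫ t, ‖weilMellin u (1 / 2 + t * I)‖ ^ 2 ∂μ := integral_mono hind hint hle
    _ = weilWindowForm a u := heq.symm

/-! ## One window bounds the spectral mass of a whole interval of length `π/a` (Jordan's inequality) -/

/-- **Jordan**: `8a/π² ≤ ‖û_{a,τ}(½+it)‖²` whenever `|t − τ| ≤ π/(2a)` (`sin x ≥ (2/π)x` on `[0, π/2]`). -/
theorem le_norm_sq_weilMellin_modulated_of_abs_le (ha : 0 < a) {τ t : ℝ} (h : |t - τ| ≤ π / (2 * a)) :
    8 * a / π ^ 2 ≤ ‖weilMellin (fun x ↦ cexp (I * ((-τ) * x : ℝ)) * chi a 0 x) (1 / 2 + t * I)‖ ^ 2 := by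
  rw [weilMellin_modulated_chi_zero]
  have hπ : 4 ≤ π ^ 2 := by nlinarith [Real.pi_gt_three]
  rcases eq_or_ne t τ with rfl | ht
  · rw [show t + -t = (0 : ℝ) by ring, norm_sq_weilMellin_chi_zero_zero ha, div_le_iff₀ (by positivity)]
    nlinarith
  · have hs : t + -τ ≠ 0 := by rw [← sub_eq_add_neg]; exact sub_ne_zero.2 ht
    rw [norm_sq_weilMellin_chi_zero ha hs]
    set s := t + -τ with hs_def
    have hs' : |s| ≤ π / (2 * a) := by rw [hs_def, ← sub_eq_add_neg]; exact h
    have hs2 : 0 < s ^ 2 := by positivity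
    have hx : |a * s| ≤ π / 2 := by
      rw [abs_mul, abs_of_pos ha]
      calc a * |s| ≤ a * (π / (2 * a)) := mul_le_mul_of_nonneg_left hs' ha.le
        _ = π / 2 := by field_simp
    have h1 := Real.mul_le_sin (abs_nonneg (a * s)) hx
    have h2 : Real.sin |a * s| ^ 2 = Real.sin (a * s) ^ 2 := by
      rcases abs_choice (a * s) with h' | h' <;> rw [h']; simp [Real.sin_neg]
    have h0 : 0 ≤ 2 / π * |a * s| := by positivity
    have hj : (2 / π) ^ 2 * (a * s) ^ 2 ≤ Real.sin (a * s) ^ 2 := by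
      calc (2 / π) ^ 2 * (a * s) ^ 2 = (2 / π * |a * s|) ^ 2 := by rw [mul_pow (2 / π) |a * s|, sq_abs]
        _ ≤ Real.sin |a * s| ^ 2 := pow_le_pow_left₀ h0 h1 2
        _ = Real.sin (a * s) ^ 2 := h2
    rw [le_div_iff₀ (by positivity)]
    calc 8 * a / π ^ 2 * (a * s ^ 2) = 2 * ((2 / π) ^ 2 * (a * s) ^ 2) := by field_simp; ring
      _ ≤ 2 * Real.sin (a * s) ^ 2 := by gcongr

/-- A measure integrating `(1+t²)⁻¹` gives finite mass to every bounded interval. -/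
theorem measure_Icc_lt_top_of_integrable {μ : Measure ℝ} (hI : Integrable (fun t : ℝ ↦ (1 + t ^ 2)⁻¹) μ)
    (b c : ℝ) : μ (Icc b c) < ⊤ := by
  set R : ℝ := max |b| |c| with hR
  have hε : (0 : ℝ) < (1 + R ^ 2)⁻¹ := by positivity
  refine lt_of_le_of_lt (measure_mono fun t ht ↦ ?_) (hI.measure_norm_ge_lt_top hε)
  have htR : |t| ≤ R := abs_le.2 ⟨by linarith [ht.1, neg_abs_le b, le_max_left |b| |c|],
    by linarith [ht.2, le_abs_self c, le_max_right |b| |c|]⟩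
  have ht2 : t ^ 2 ≤ R ^ 2 := by rw [← sq_abs t]; exact pow_le_pow_left₀ (abs_nonneg t) htR 2
  show (1 + R ^ 2)⁻¹ ≤ ‖(1 + t ^ 2)⁻¹‖
  rw [Real.norm_of_nonneg (by positivity)]
  exact inv_anti₀ (by positivity) (by linarith)

/-- **ONE WINDOW BOUNDS THE SPECTRAL MASS OF A WHOLE INTERVAL** (one window, RH-free).  For `a > 0`, every
positive `μ` representing Weil's form on the tests of `[-a, a]` and every `τ ∈ ℝ`:

  `(8a/π²) · μ[τ − π/(2a), τ + π/(2a)] ≤ weilWindowForm a (e^{−iτx}χ_0)`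

— under RH (`ZetaWindowAtomsRH`) the number of zeros with `|γ − τ| ≤ π/(2a)`, counted with multiplicity, is at
most `π²·W_a(e^{−iτx}χ_0)/(8a)`: the positivity form of the classical short-interval count
`N(T+h) − N(T−h) ≪ log T/log log T`, `h ≍ 1/log log T`. -/
theorem mul_measureReal_Icc_le_weilWindowForm (ha : 0 < a) {μ : Measure ℝ}
    (hμ : ∀ g : ℝ → ℂ, IsWeilTest g → tsupport g ⊆ Icc (-a) a →
      Integrable (fun t : ℝ ↦ ‖weilMellin g (1 / 2 + t * I)‖ ^ 2) μ ∧
        weilQuadratic g = ((∫ t, ‖weilMellin g (1 / 2 + t * I)‖ ^ 2 ∂μ : ℝ) : ℂ)) (τ : ℝ) :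
    8 * a / π ^ 2 * μ.real (Icc (τ - π / (2 * a)) (τ + π / (2 * a))) ≤
      weilWindowForm a (fun x ↦ cexp (I * ((-τ) * x : ℝ)) * chi a 0 x) := by
  obtain ⟨hint, heq⟩ := weilWindowForm_modulated_eq_integral ha hμ τ
  set u : ℝ → ℂ := fun x ↦ cexp (I * ((-τ) * x : ℝ)) * chi a 0 x with hu
  set J : Set ℝ := Icc (τ - π / (2 * a)) (τ + π / (2 * a)) with hJ
  have h0 := measure_Icc_lt_top_of_integrable (integrable_inv_one_add_sq ha hμ) (τ - π / (2 * a)) (τ + π / (2 * a))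
  have hind : Integrable (fun t : ℝ ↦ J.indicator (fun _ ↦ 8 * a / π ^ 2) t) μ :=
    (integrable_indicator_iff measurableSet_Icc).2 (integrableOn_const h0.ne)
  have hle : ∀ t : ℝ, J.indicator (fun _ ↦ 8 * a / π ^ 2) t ≤ ‖weilMellin u (1 / 2 + t * I)‖ ^ 2 := by
    intro t
    by_cases ht : t ∈ J
    · rw [indicator_of_mem ht, hu]
      refine le_norm_sq_weilMellin_modulated_of_abs_le ha (abs_le.2 ⟨?_, ?_⟩) <;> linarith [ht.1, ht.2]
    · rw [indicator_of_notMem ht]; positivity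
  calc 8 * a / π ^ 2 * μ.real J = ∫ t, J.indicator (fun _ ↦ 8 * a / π ^ 2) t ∂μ := by
        rw [integral_indicator_const _ measurableSet_Icc, smul_eq_mul, mul_comm]
    _ ≤ ∫ t, ‖weilMellin u (1 / 2 + t * I)‖ ^ 2 ∂μ := integral_mono hind hint hle
    _ = weilWindowForm a u := heq.symm

/-! ## The normalised Fejér profile: bounded by `1`, by `(a²(t−τ)²)⁻¹`, and by `4(1+τ²)(1+t²)⁻¹` -/

/-- `‖û_{a,τ}(½+it)‖²/(2a) ≤ 1`. -/
theorem norm_sq_weilMellin_modulated_div_le_one (ha : 0 < a) (τ t : ℝ) :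
    ‖weilMellin (fun x ↦ cexp (I * ((-τ) * x : ℝ)) * chi a 0 x) (1 / 2 + t * I)‖ ^ 2 / (2 * a) ≤ 1 := by
  rw [weilMellin_modulated_chi_zero, div_le_one (by positivity)]
  exact norm_sq_weilMellin_chi_zero_le ha _

/-- `‖û_{a,τ}(½+it)‖²/(2a) ≤ (a²(t−τ)²)⁻¹` off the centre. -/
theorem norm_sq_weilMellin_modulated_div_le_inv_sq (ha : 0 < a) {τ t : ℝ} (ht : t ≠ τ) :
    ‖weilMellin (fun x ↦ cexp (I * ((-τ) * x : ℝ)) * chi a 0 x) (1 / 2 + t * I)‖ ^ 2 / (2 * a) ≤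
      (a ^ 2 * (t - τ) ^ 2)⁻¹ := by
  rw [weilMellin_modulated_chi_zero]
  have hs : t + -τ ≠ 0 := by rw [← sub_eq_add_neg]; exact sub_ne_zero.2 ht
  have hs2 : 0 < (t - τ) ^ 2 := by have := sub_ne_zero.2 ht; positivity
  have h := norm_sq_weilMellin_chi_zero_le_div ha hs
  rw [div_le_iff₀ (by positivity)]
  calc ‖weilMellin (chi a 0) (1 / 2 + ((t + -τ : ℝ) : ℂ) * I)‖ ^ 2 ≤ 2 / (a * (t + -τ) ^ 2) := h
    _ = (a ^ 2 * (t - τ) ^ 2)⁻¹ * (2 * a) := by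
        rw [← sub_eq_add_neg]
        field_simp

/-- **Uniform majorant**: for `a ≥ 1`, `‖û_{a,τ}(½+it)‖²/(2a) ≤ 4(1+τ²)(1+t²)⁻¹` (`min(1, (t−τ)⁻²) ≤ 2/(1+(t−τ)²)`
and `1 + t² ≤ 2(1+τ²)(1+(t−τ)²)`). -/
theorem norm_sq_weilMellin_modulated_div_le_majorant (ha : 1 ≤ a) (τ t : ℝ) :
    ‖weilMellin (fun x ↦ cexp (I * ((-τ) * x : ℝ)) * chi a 0 x) (1 / 2 + t * I)‖ ^ 2 / (2 * a) ≤
      4 * (1 + τ ^ 2) * (1 + t ^ 2)⁻¹ := by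
  have ha0 : 0 < a := by linarith
  have key : 1 + t ^ 2 ≤ 2 * (1 + τ ^ 2) * (1 + (t - τ) ^ 2) := by
    nlinarith [sq_nonneg (t - 2 * τ), sq_nonneg (τ * (t - τ))]
  set F := ‖weilMellin (fun x ↦ cexp (I * ((-τ) * x : ℝ)) * chi a 0 x) (1 / 2 + t * I)‖ ^ 2 / (2 * a)
    with hF
  have h1 : F ≤ 1 := norm_sq_weilMellin_modulated_div_le_one ha0 τ t
  have h4 : F ≤ 2 / (1 + (t - τ) ^ 2) := by
    rcases eq_or_ne t τ with rfl | ht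
    · rw [sub_self]; norm_num; exact h1.trans (by norm_num)
    · have hs2 : 0 < (t - τ) ^ 2 := by have := sub_ne_zero.2 ht; positivity
      have h2 := norm_sq_weilMellin_modulated_div_le_inv_sq ha0 ht
      have ha2 : 1 ≤ a ^ 2 := by nlinarith
      have h3 : F ≤ ((t - τ) ^ 2)⁻¹ := by
        refine h2.trans ?_
        rw [inv_le_inv₀ (by positivity) hs2]
        calc (t - τ) ^ 2 = 1 * (t - τ) ^ 2 := by ring
          _ ≤ a ^ 2 * (t - τ) ^ 2 := mul_le_mul_of_nonneg_right ha2 hs2.le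
      by_cases hs : 1 ≤ (t - τ) ^ 2
      · refine h3.trans ?_
        rw [inv_eq_one_div, div_le_div_iff₀ hs2 (by positivity)]
        nlinarith
      · refine h1.trans ?_
        rw [le_div_iff₀ (by positivity)]
        nlinarith
  refine h4.trans ?_
  rw [← div_eq_mul_inv, div_le_div_iff₀ (by positivity) (by positivity)]
  nlinarith [key]

/-! ## The rate: `0 ≤ W_a(u_{a,τ}) − 2a·μ{τ} ≤ (2/a)·∫ (t−τ)⁻² dμ` -/

/-- **Shifted majorant**: `‖û_{a,τ}(½+it)‖² ≤ 2a·𝟙_{τ}(t) + (2/a)·((t−τ)²)⁻¹` (Lean's `0⁻¹ = 0` at `t = τ`). -/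
theorem norm_sq_weilMellin_modulated_le_majorant (ha : 0 < a) (τ t : ℝ) :
    ‖weilMellin (fun x ↦ cexp (I * ((-τ) * x : ℝ)) * chi a 0 x) (1 / 2 + t * I)‖ ^ 2 ≤
      ({τ} : Set ℝ).indicator (fun _ ↦ 2 * a) t + 2 / a * ((t - τ) ^ 2)⁻¹ := by
  rw [weilMellin_modulated_chi_zero]
  have h := norm_sq_weilMellin_chi_zero_le_majorant ha (t + -τ)
  have e : ((t + -τ : ℝ) : ℂ) = ((t + -τ : ℝ) : ℂ) := rfl
  rcases eq_or_ne t τ with rfl | ht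
  · rw [indicator_of_mem (mem_singleton _)]
    rw [show t + -t = (0 : ℝ) by ring] at h ⊢
    rw [indicator_of_mem (mem_singleton _)] at h
    simpa using h
  · rw [indicator_of_notMem (by simpa using ht), zero_add]
    have hne : t + -τ ≠ 0 := by rw [← sub_eq_add_neg]; exact sub_ne_zero.2 ht
    rw [indicator_of_notMem (by simpa using hne), zero_add, ← sub_eq_add_neg] at h
    exact h

/-- **THE RATE OF COMPLETENESS** (one window, RH-free).  For `a > 0`, every positive `μ` representing Weil's
form on the tests of `[-a, a]`, and every `τ` with `(t−τ)⁻² ∈ L¹(μ)` (the atom at `τ` itself is not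
counted: `0⁻¹ = 0`):

  `weilWindowForm a (e^{−iτx}χ_0) ≤ 2a·μ{τ} + (2/a)·∫ ((t−τ)²)⁻¹ dμ(t)`,

so with `two_mul_mul_atom_le_weilWindowForm`: `0 ≤ W_a(u_{a,τ})/(2a) − μ{τ} ≤ a⁻²·∫(t−τ)⁻²dμ`. -/
theorem weilWindowForm_modulated_le_atom_add (ha : 0 < a) {μ : Measure ℝ}
    (hμ : ∀ g : ℝ → ℂ, IsWeilTest g → tsupport g ⊆ Icc (-a) a →
      Integrable (fun t : ℝ ↦ ‖weilMellin g (1 / 2 + t * I)‖ ^ 2) μ ∧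
        weilQuadratic g = ((∫ t, ‖weilMellin g (1 / 2 + t * I)‖ ^ 2 ∂μ : ℝ) : ℂ)) (τ : ℝ)
    (hM : Integrable (fun t : ℝ ↦ ((t - τ) ^ 2)⁻¹) μ) :
    weilWindowForm a (fun x ↦ cexp (I * ((-τ) * x : ℝ)) * chi a 0 x) ≤
      2 * a * μ.real {τ} + 2 / a * ∫ t, ((t - τ) ^ 2)⁻¹ ∂μ := by
  obtain ⟨hint, heq⟩ := weilWindowForm_modulated_eq_integral ha hμ τ
  have h0 := measure_singleton_lt_top_of_integrable (integrable_inv_one_add_sq ha hμ) τ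
  have hind : Integrable (fun t : ℝ ↦ ({τ} : Set ℝ).indicator (fun _ ↦ 2 * a) t) μ :=
    (integrable_indicator_iff (measurableSet_singleton τ)).2 (integrableOn_const h0.ne)
  rw [heq]
  calc ∫ t, ‖weilMellin (fun x ↦ cexp (I * ((-τ) * x : ℝ)) * chi a 0 x) (1 / 2 + t * I)‖ ^ 2 ∂μ
      ≤ ∫ t, ({τ} : Set ℝ).indicator (fun _ ↦ 2 * a) t + 2 / a * ((t - τ) ^ 2)⁻¹ ∂μ :=
        integral_mono hint (hind.add (hM.const_mul _)) (norm_sq_weilMellin_modulated_le_majorant ha τ)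
    _ = 2 * a * μ.real {τ} + 2 / a * ∫ t, ((t - τ) ^ 2)⁻¹ ∂μ := by
        rw [integral_add hind (hM.const_mul _), integral_indicator_const _ (measurableSet_singleton τ),
          integral_const_mul, smul_eq_mul, mul_comm (μ.real {τ})]

/-! ## All windows: THE MULTIPLICITY IS THE LIMIT -/

/-- **THE WINDOW CERTIFICATES ARE COMPLETE: `W_a(e^{−iτx}χ_0)/(2a) → μ{τ}`.**  Let `μ` be a positive
measure representing Weil's form on all tests (`W(g ⋆ g̃) = ∫‖ĝ(½+it)‖²dμ`).  Then for every `τ ∈ ℝ`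

  `weilWindowForm a (e^{−iτx}χ_0) / (2a) → μ{τ}`   (`a → ∞`).

(`W_a(u_{a,τ}) = ∫ 2sin²(a(t−τ))/(a(t−τ)²) dμ(t)`; the normalised Fejér profile tends to `𝟙_{τ}` pointwise
and is dominated by `4(1+τ²)(1+t²)⁻¹ ∈ L¹(μ)` — the growth law of every Weil measure,
`WeilBochnerMeasureGrowth`.)  With `two_mul_mul_atom_le_weilWindowForm`: `μ{τ} = inf_a W_a(u_{a,τ})/(2a)`
along `a → ∞` — the spectral mass at every height is the asymptotic SLOPE of the window forms. -/
theorem tendsto_weilWindowForm_modulated_div {μ : Measure ℝ}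
    (hμ : ∀ g : ℝ → ℂ, IsWeilTest g →
      Integrable (fun t : ℝ ↦ ‖weilMellin g (1 / 2 + t * I)‖ ^ 2) μ ∧
        weilQuadratic g = ((∫ t, ‖weilMellin g (1 / 2 + t * I)‖ ^ 2 ∂μ : ℝ) : ℂ)) (τ : ℝ) :
    Tendsto (fun a : ℝ ↦ weilWindowForm a (fun x ↦ cexp (I * ((-τ) * x : ℝ)) * chi a 0 x) / (2 * a))
      atTop (𝓝 (μ.real {τ})) := by
  have hI : Integrable (fun t : ℝ ↦ (1 + t ^ 2)⁻¹) μ :=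
    integrable_inv_one_add_sq one_pos (fun g hg _ ↦ hμ g hg)
  set F : ℝ → ℝ → ℝ := fun a t ↦
    ‖weilMellin (fun x ↦ cexp (I * ((-τ) * x : ℝ)) * chi a 0 x) (1 / 2 + t * I)‖ ^ 2 / (2 * a) with hF
  have hrepr : ∀ a : ℝ, 0 < a →
      Integrable (fun t : ℝ ↦
          ‖weilMellin (fun x ↦ cexp (I * ((-τ) * x : ℝ)) * chi a 0 x) (1 / 2 + t * I)‖ ^ 2) μ ∧
        weilWindowForm a (fun x ↦ cexp (I * ((-τ) * x : ℝ)) * chi a 0 x) =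
          ∫ t, ‖weilMellin (fun x ↦ cexp (I * ((-τ) * x : ℝ)) * chi a 0 x) (1 / 2 + t * I)‖ ^ 2 ∂μ :=
    fun a ha ↦ weilWindowForm_modulated_eq_integral ha (fun g hg _ ↦ hμ g hg) τ
  have hlim : Tendsto (fun a ↦ ∫ t, F a t ∂μ) atTop
      (𝓝 (∫ t, ({τ} : Set ℝ).indicator (fun _ ↦ (1 : ℝ)) t ∂μ)) := by
    refine tendsto_integral_filter_of_dominated_convergence (fun t ↦ 4 * (1 + τ ^ 2) * (1 + t ^ 2)⁻¹)
      ?_ ?_ (hI.const_mul _) ?_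
    · filter_upwards [eventually_gt_atTop (0 : ℝ)] with a ha
      exact ((hrepr a ha).1.div_const (2 * a)).aestronglyMeasurable
    · filter_upwards [eventually_ge_atTop (1 : ℝ)] with a ha
      refine Eventually.of_forall fun t ↦ ?_
      rw [Real.norm_of_nonneg (by positivity)]
      exact norm_sq_weilMellin_modulated_div_le_majorant ha τ t
    · refine Eventually.of_forall fun t ↦ ?_
      rcases eq_or_ne t τ with rfl | ht
      · rw [indicator_of_mem (mem_singleton _)]
        refine tendsto_const_nhds.congr' ?_
        filter_upwards [eventually_gt_atTop (0 : ℝ)] with a ha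
        show (1 : ℝ) = F a t
        rw [hF]
        dsimp only
        rw [norm_sq_weilMellin_modulated_chi_zero_self ha, div_self (by positivity)]
      · rw [indicator_of_notMem (by simpa using ht)]
        have hs2 : 0 < (t - τ) ^ 2 := by have := sub_ne_zero.2 ht; positivity
        have h0 : Tendsto (fun a : ℝ ↦ (a ^ 2 * (t - τ) ^ 2)⁻¹) atTop (𝓝 0) :=
          tendsto_inv_atTop_zero.comp ((tendsto_pow_atTop two_ne_zero).atTop_mul_const hs2)
        refine squeeze_zero' ?_ ?_ h0
        · filter_upwards [eventually_gt_atTop (0 : ℝ)] with a ha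
          positivity
        · filter_upwards [eventually_gt_atTop (0 : ℝ)] with a ha
          exact norm_sq_weilMellin_modulated_div_le_inv_sq ha ht
  rw [integral_indicator_const _ (measurableSet_singleton τ), smul_eq_mul, mul_one] at hlim
  refine hlim.congr' ?_
  filter_upwards [eventually_gt_atTop (0 : ℝ)] with a ha
  rw [(hrepr a ha).2, hF]
  exact integral_div _ _

end Summit.Ventures.WeilGRH
-- Build note (weil-3 gen13, 2026-08-24): byte-identical re-land under lead ruling R14-3 (APPEND REMEDY) to trigger the hub build; p371026 accepted 2026-08-23T19:37Z.
end
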